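import Mathlib.GroupTheory.PresentedGroup
import Mathlib.GroupTheory.FreeGroup.IsFreeGroup
import Mathlib.GroupTheory.Perm.Fin
import Literature.GroupTheory.CombinatorialGroupTheory.PuncturedSurfaceGroup
import HarnessLib

/-!
# The punctured surface group `Γ_{g,r}` is free for `r ≥ 1`

`Γ_{g,r} = ⟨a₁, b₁, …, a_g, b_g, c₁, …, c_r ∣ [a₁,b₁]⋯[a_g,b_g]·c₁⋯c_r = 1⟩` (abc-iut-L3-t1's
`PuncturedSurfaceGroup g r`, [SemiAnbd] Example 2.10 [cite: MochizukiSemiAnbd2006, Ex. 2.10 p.31]).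
For `r ≥ 1` the single relator can be solved for the first puncture generator,
`c₁ = ([a₁,b₁]⋯[a_g,b_g])⁻¹ (c₂⋯c_r)⁻¹`, so `Γ_{g,r+1}` is FREE on `a_i, b_i, c₂, …, c_{r+1}`
(a Tietze transformation; rank `2g + r`).  We record this (`nonempty_mulEquiv_freeGroup`) and that
`Γ_{g,r+1}` is nonabelian when `(g, r+1)` is hyperbolic, i.e. `2g + r ≥ 2` (`exists_mul_ne_mul`).
Theorems only (the isomorphism is packaged as `Nonempty (_ ≃* _)`).
-/

namespace Literature.GroupTheory.CombinatorialGroupTheory.PuncturedSurfaceGroup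

variable (g r : ℕ)

/-- The relator of `Γ_{g,r+1}` with the first puncture generator isolated:
`[a₁,b₁]⋯[a_g,b_g] · (c₁ · (c₂⋯c_{r+1}))`. [cite: MochizukiSemiAnbd2006, Ex. 2.10 p.31] -/
theorem relator_succ :
    relator g (r + 1) =
      ((List.finRange g).map fun i =>
          genA (r := r + 1) i * genB (r := r + 1) i * (genA (r := r + 1) i)⁻¹ *
            (genB (r := r + 1) i)⁻¹).prod *
        (genC (g := g) 0 * ((List.finRange r).map fun j => genC (g := g) (Fin.succ j)).prod) := by
  rw [relator, List.finRange_succ, List.map_cons, List.prod_cons, List.map_map]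
  rfl

/-- **`Γ_{g,r+1}` is free of rank `2g + r`**: an isomorphism
`Γ_{g,r+1} ≃* F((Fin g × Bool) ⊕ Fin r)` sending `a_i, b_i ↦` the corresponding free generators,
`c_{j+2} ↦ inr j` and `c₁ ↦ ([a₁,b₁]⋯[a_g,b_g])⁻¹ (c₂⋯c_{r+1})⁻¹` (Tietze: eliminate `c₁` using the
single relator). [cite: MochizukiSemiAnbd2006, Ex. 2.10 p.31] -/
theorem nonempty_mulEquiv_freeGroup :
    Nonempty (PuncturedSurfaceGroup g (r + 1) ≃* FreeGroup ((Fin g × Bool) ⊕ Fin r)) := by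
  classical
  -- the two halves of the relator, in `F(gens)` and in the target free group `F`
  let comm : FreeGroup (puncturedSurfaceGen g (r + 1)) :=
    ((List.finRange g).map fun i =>
      genA (r := r + 1) i * genB (r := r + 1) i * (genA (r := r + 1) i)⁻¹ *
        (genB (r := r + 1) i)⁻¹).prod
  let cs : FreeGroup (puncturedSurfaceGen g (r + 1)) :=
    ((List.finRange r).map fun j => genC (g := g) (Fin.succ j)).prod
  have hrel_eq : relator g (r + 1) = comm * (genC (g := g) 0 * cs) := relator_succ g r
  let A : FreeGroup ((Fin g × Bool) ⊕ Fin r) := ((List.finRange g).map fun i =>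
      FreeGroup.of (Sum.inl (i, false)) * FreeGroup.of (Sum.inl (i, true)) *
        (FreeGroup.of (Sum.inl (i, false)))⁻¹ * (FreeGroup.of (Sum.inl (i, true)))⁻¹).prod
  let B : FreeGroup ((Fin g × Bool) ⊕ Fin r) :=
    ((List.finRange r).map fun j => FreeGroup.of (Sum.inr j)).prod
  -- the assignment on generators of `Γ_{g,r+1}`: `c₁ ↦ A⁻¹ B⁻¹`, `c_{j+2} ↦ inr j`
  let f : puncturedSurfaceGen g (r + 1) → FreeGroup ((Fin g × Bool) ⊕ Fin r) := fun x =>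
    match x with
    | Sum.inl y => FreeGroup.of (Sum.inl y)
    | Sum.inr j => Fin.cases (A⁻¹ * B⁻¹) (fun j' => FreeGroup.of (Sum.inr j')) j
  have hf0 : f (Sum.inr 0) = A⁻¹ * B⁻¹ := by simp [f]
  have hfs : ∀ j : Fin r, f (Sum.inr (Fin.succ j)) = FreeGroup.of (Sum.inr j) := fun j => by simp [f]
  have hfA : FreeGroup.lift f comm = A := by
    simp only [comm, A, map_list_prod, List.map_map, Function.comp_def, map_mul, map_inv, genA, genB,
      FreeGroup.lift_apply_of, f]
  have hfB : FreeGroup.lift f cs = B := by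
    simp only [cs, B, map_list_prod, List.map_map, Function.comp_def, genC, FreeGroup.lift_apply_of, hfs]
  have hrel : ∀ w ∈ ({relator g (r + 1)} : Set (FreeGroup (puncturedSurfaceGen g (r + 1)))),
      FreeGroup.lift f w = 1 := by
    intro w hw
    rw [Set.mem_singleton_iff] at hw
    rw [hw, hrel_eq, map_mul, map_mul, hfA, hfB, genC, FreeGroup.lift_apply_of, hf0]
    group
  let φ : PuncturedSurfaceGroup g (r + 1) →* FreeGroup ((Fin g × Bool) ⊕ Fin r) :=
    PresentedGroup.toGroup hrel
  let ψ : FreeGroup ((Fin g × Bool) ⊕ Fin r) →* PuncturedSurfaceGroup g (r + 1) :=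
    FreeGroup.lift fun y =>
      match y with
      | Sum.inl x => PresentedGroup.of (Sum.inl x)
      | Sum.inr j => PresentedGroup.of (Sum.inr (Fin.succ j))
  -- images of `A`, `B` under `ψ` are the classes of `comm`, `cs`
  have hψA : ψ A = PresentedGroup.mk _ comm := by
    simp only [A, comm, map_list_prod, List.map_map, Function.comp_def, map_mul, map_inv, ψ,
      FreeGroup.lift_apply_of, genA, genB]
    rfl
  have hψB : ψ B = PresentedGroup.mk _ cs := by
    simp only [B, cs, map_list_prod, List.map_map, Function.comp_def, ψ, FreeGroup.lift_apply_of,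
      genC]
    rfl
  -- the relation in `Γ`: `comm · (c₁ · cs) = 1`, i.e. `c₁ = comm⁻¹ cs⁻¹`
  have hc0 : (PresentedGroup.of (Sum.inr 0) : PuncturedSurfaceGroup g (r + 1)) =
      (PresentedGroup.mk _ comm)⁻¹ * (PresentedGroup.mk _ cs)⁻¹ := by
    have h1 := PresentedGroup.one_of_mem (rels := ({relator g (r + 1)} : Set _))
      (Set.mem_singleton (relator g (r + 1)))
    have h1' : PresentedGroup.mk ({relator g (r + 1)} : Set _) (comm * (genC (g := g) 0 * cs)) = 1 := by
      rw [← hrel_eq]; exact h1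
    rw [map_mul, map_mul] at h1'
    exact eq_mul_inv_of_mul_eq (eq_inv_of_mul_eq_one_right h1')
  have h₁ : ψ.comp φ = MonoidHom.id _ := by
    apply PresentedGroup.ext
    intro x
    rw [MonoidHom.comp_apply, MonoidHom.id_apply]
    change ψ (PresentedGroup.toGroup hrel (PresentedGroup.of x)) = _
    rw [PresentedGroup.toGroup.of]
    rcases x with y | j
    · simp [f, ψ]
    · refine Fin.cases ?_ (fun j' => ?_) j
      · rw [hf0, map_mul, map_inv, map_inv, hψA, hψB, hc0]
      · rw [hfs]
        simp [ψ]
  have h₂ : φ.comp ψ = MonoidHom.id _ := by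
    apply FreeGroup.ext_hom
    intro y
    rw [MonoidHom.comp_apply, MonoidHom.id_apply]
    rcases y with x | j
    · simp only [ψ, FreeGroup.lift_apply_of]
      change PresentedGroup.toGroup hrel (PresentedGroup.of (Sum.inl x)) = _
      rw [PresentedGroup.toGroup.of]
    · simp only [ψ, FreeGroup.lift_apply_of]
      change PresentedGroup.toGroup hrel (PresentedGroup.of (Sum.inr (Fin.succ j))) = _
      rw [PresentedGroup.toGroup.of, hfs]
  exact ⟨MonoidHom.toMulEquiv φ ψ h₁ h₂⟩

variable {g r} in
/-- For a hyperbolic type `(g, r+1)` (i.e. `2g + r ≥ 2`), `Γ_{g,r+1}` is nonabelian: two distinct free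
generators do not commute (checked in the symmetric group `S₃`). [cite: MochizukiSemiAnbd2006, Ex. 2.10 p.31] -/
theorem exists_mul_ne_mul (h : IsHyperbolicType g (r + 1)) :
    ∃ x y : PuncturedSurfaceGroup g (r + 1), x * y ≠ y * x := by
  classical
  obtain ⟨e⟩ := nonempty_mulEquiv_freeGroup g r
  -- two distinct letters
  have hgen : ∃ u v : (Fin g × Bool) ⊕ Fin r, u ≠ v := by
    unfold IsHyperbolicType at h
    by_cases hg : g = 0
    · subst hg
      refine ⟨Sum.inr ⟨0, by omega⟩, Sum.inr ⟨1, by omega⟩, ?_⟩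
      simp [Fin.ext_iff]
    · have hg' : 0 < g := Nat.pos_of_ne_zero hg
      exact ⟨Sum.inl (⟨0, hg'⟩, false), Sum.inl (⟨0, hg'⟩, true), by simp⟩
  obtain ⟨u, v, huv⟩ := hgen
  refine ⟨e.symm (FreeGroup.of u), e.symm (FreeGroup.of v), fun heq => ?_⟩
  have heq' : FreeGroup.of u * FreeGroup.of v = FreeGroup.of v * FreeGroup.of u := by
    have := congrArg e heq
    simpa using this
  let s : (Fin g × Bool) ⊕ Fin r → Equiv.Perm (Fin 3) := fun w =>
    if w = u then Equiv.swap 0 1 else if w = v then Equiv.swap 1 2 else 1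
  have hsu : s u = Equiv.swap 0 1 := by simp [s]
  have hsv : s v = Equiv.swap 1 2 := by simp [s, Ne.symm huv]
  have h3 := congrArg (FreeGroup.lift s) heq'
  rw [map_mul, map_mul, FreeGroup.lift_apply_of, FreeGroup.lift_apply_of, hsu, hsv] at h3
  exact absurd h3 (by decide)

end Literature.GroupTheory.CombinatorialGroupTheory.PuncturedSurfaceGroup
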